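import Mathlib
import Summits.Ventures.HodgeRepro.CMType
import Summits.Ventures.HodgeRepro.HodgeSets
import Summits.Ventures.HodgeRepro.CMRank
import Summits.Ventures.HodgeRepro.MuTable

/-!
# Kernel-decidable forms of the μ-table (blind cell `pub-hodge-repro`, seat p2)

The ℚ-valued table `typeMatrix Φ` / `weight Φ s` cannot be evaluated by kernel `decide` (rational
normalisation is not kernel-reducible), so we record integer-valued copies `muTableZ`, `weightN`
and the transfer lemmas: an identity of ℚ-tables follows from the corresponding identity of integer
tables, which `decide` settles on the groups of order `6`, `8`, `12`.
-/

open Finset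
open scoped Pointwise

namespace HodgeRepro

variable {G : Type*} [Group G] [DecidableEq G]

/-- Integer copy of the μ-table: `(g, s) ↦ [s ∈ gΦ] ∈ ℤ`. -/
def muTableZ (Φ : Finset G) : Matrix G G ℤ := fun g s => if s ∈ g • Φ then 1 else 0

/-- The weight of `x_s` as a `0/1`-valued function `G → ℕ` (decidable version of `weight`). -/
def weightN (Φ : Finset G) (s : G) : G → ℕ := fun g => if s ∈ g • Φ then 1 else 0

/-- The set of distinct weights of `Φ` (decidable version). -/
def weightsN [Fintype G] (Φ : Finset G) : Finset (G → ℕ) := univ.image (weightN Φ)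

/-- The μ-row of a subset `S` as a function `G → ℕ`. -/
def muRow (Φ S : Finset G) : G → ℕ := fun g => muVal Φ S g

section Transfer

variable [Fintype G]

omit [Fintype G] in
/-- `typeMatrix Φ` is the cast of the integer table. -/
theorem typeMatrix_eq_map_muTableZ (Φ : Finset G) :
    typeMatrix Φ = (muTableZ Φ).map (Int.castRingHom ℚ) := by
  ext g s
  simp only [typeMatrix, ind, muTableZ, Matrix.map_apply]
  split_ifs <;> simp

omit [Fintype G] in
/-- `weight Φ s` is the cast of the integer weight. -/
theorem weight_eq_cast (Φ : Finset G) (s : G) : weight Φ s = fun g => (weightN Φ s g : ℚ) := by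
  ext g
  simp only [weight, typeMatrix, ind, weightN]
  split_ifs <;> simp

omit [Fintype G] in
/-- Two weights agree iff their integer versions agree. -/
theorem weight_eq_weight_iff (Φ : Finset G) (s t : G) :
    weight Φ s = weight Φ t ↔ weightN Φ s = weightN Φ t := by
  rw [weight_eq_cast, weight_eq_cast]
  constructor
  · intro h
    ext g
    have := congrFun h g
    exact_mod_cast this
  · intro h
    rw [h]

/-- The set of weights is the cast of the set of integer weights. -/
theorem image_weight_eq (Φ : Finset G) :
    univ.image (weight Φ) = (weightsN Φ).image (fun w : G → ℕ => fun g => (w g : ℚ)) := by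
  unfold weightsN
  rw [image_image]
  refine image_congr ?_
  intro s _
  exact weight_eq_cast Φ s

/-- The number of distinct weights equals the number of distinct integer weights. -/
theorem card_image_weight (Φ : Finset G) :
    (univ.image (weight Φ)).card = (weightsN Φ).card := by
  rw [image_weight_eq, card_image_of_injective]
  intro v w h
  ext g
  have := congrFun h g
  simp only at this
  exact_mod_cast this

/-- The μ-row of `S` read from the ℚ-table is the cast of `muRow`. -/
theorem typeMatrix_mulVec_ind_eq_cast (Φ S : Finset G) :
    (typeMatrix Φ).mulVec (ind S) = fun g => (muRow Φ S g : ℚ) := by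
  ext g
  rw [typeMatrix_mulVec_ind]
  rfl

end Transfer

end HodgeRepro
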